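import Literature.NumberTheory.EllipticCurves.UniformizationProofs
import Mathlib.Tactic
import HarnessLib

/-!
# Crux `RealOnePeriodRelations` (stmt-KontsevichZagierPeriods-10042), line `nash-retraction-thin-strip`:
# stub `stub_quarticLattice` — a lattice for the resolvent cubic of a separable quartic

Let `q(x) = a₄x⁴ + a₃x³ + a₂x² + a₁x + a₀` be a real quartic (`a₄ ≠ 0`) without multiple complex
roots and let `ε` be a real root of `q`.  Write the Taylor expansion of `q` at `ε` as
`q(ε + t) = c₃t + c₂t² + c₁t³ + a₄t⁴` (`c₃ = q′(ε) = 4a₄ε³ + 3a₃ε² + 2a₂ε + a₁ ≠ 0`,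
`c₂ = q″(ε)/2 = 6a₄ε² + 3a₃ε + a₂`, `c₁ = q‴(ε)/6 = 4a₄ε + a₃`).  The Möbius chart `v = c₃/(x − ε)`
transports `dx/√q` to `dv/√D` for the MONIC resolvent cubic

  `D(v) = v³ + c₂v² + c₁c₃v + a₄c₃²`,   `v⁴ · q(ε + c₃/v) = c₃² · D(v)`.

This file proves that the depressed form `x³ + A′x + B′` of `D` (`A′ = c₁c₃ − c₂²/3`,
`B′ = a₄c₃² − c₁c₃c₂/3 + 2c₂³/27`) is nonsingular, `4A′³ + 27B′² ≠ 0`, and hence, by the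
Uniformization Theorem (`PeriodPair.uniformization_holds`, Silverman AEC VI.5.1), that there is a
period pair `L` with `g₂(L) = −4A′`, `g₃(L) = −4B′` (so that `y² = 4x³ − g₂x − g₃` is
`y² = 4(x³ + A′x + B′)`).

The algebra: if `4A′³ + 27B′² = 0`, the depressed cubic has the explicit multiple root
`x₀ = −3B′/(2A′)` (resp. `x₀ = 0` if `A′ = 0`, when also `B′ = 0`), so `v₀ = x₀ − c₂/3` is a
multiple root of `D`: `D(v₀) = 0 = D′(v₀)`.  Since `D(0) = a₄c₃² ≠ 0` we have `v₀ ≠ 0`, and then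
`x₁ = ε + c₃/v₀` is a common root of `q` and `q′` by the two identities
`v⁴ · q(ε + c₃/v) = c₃² · D(v)` and `v³ · q′(ε + c₃/v) = c₃ · (4D(v) − vD′(v))`, contradicting the
separability of `q`.  Everything happens over `ℝ`; the complex separability hypothesis is only used
at real points.

References: J. H. Silverman, *The Arithmetic of Elliptic Curves*, 2nd ed., GTM 106, Springer 2009,
Thm. VI.5.1 [SilvermanAEC2009]; M. Kontsevich, D. Zagier, *Periods*, in: Mathematics Unlimited —
2001 and Beyond, Springer 2001, §1.2 [KontsevichZagier2001].
-/

noncomputable section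

open Complex

namespace Summit.KontsevichZagierPeriods.SymplecticScissors.RealOnePeriodRelations.QuarticLayer

/-- A degenerate depressed real cubic `x³ + Ax + B` (`4A³ + 27B² = 0`) has an explicit multiple
root: `x₀ = −3B/(2A)` if `A ≠ 0`, and `x₀ = 0` if `A = 0` (then `B = 0`). [folklore] -/
private lemma depressed_cubic_multiple_root (A B : ℝ) (h : 4 * A ^ 3 + 27 * B ^ 2 = 0) :
    ∃ x₀ : ℝ, x₀ ^ 3 + A * x₀ + B = 0 ∧ 3 * x₀ ^ 2 + A = 0 := by
  by_cases hA : A = 0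
  · subst hA
    have hB : B = 0 := sq_eq_zero_iff.mp (by linear_combination h / 27)
    subst hB
    exact ⟨0, by norm_num, by norm_num⟩
  · -- `x₀ = −3B/(2A)`, used only through `2A·x₀ = −3B`
    obtain ⟨x₀, hx₀⟩ : ∃ x₀ : ℝ, 2 * A * x₀ = -3 * B :=
      ⟨-3 * B / (2 * A), mul_div_cancel₀ _ (mul_ne_zero two_ne_zero hA)⟩
    refine ⟨x₀, ?_, ?_⟩
    · have h8 : (8 * A ^ 3) * (x₀ ^ 3 + A * x₀ + B) = 0 := by
        linear_combination (4 * A ^ 2 * x₀ ^ 2 - 6 * A * B * x₀ + 9 * B ^ 2 + 4 * A ^ 3) * hx₀ - B * h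
      exact (mul_eq_zero.mp h8).resolve_left (mul_ne_zero (by norm_num) (pow_ne_zero 3 hA))
    · have h4 : (4 * A ^ 2) * (3 * x₀ ^ 2 + A) = 0 := by
        linear_combination (3 * (2 * A * x₀ - 3 * B)) * hx₀ + h
      exact (mul_eq_zero.mp h4).resolve_left (mul_ne_zero (by norm_num) (pow_ne_zero 2 hA))

/-- A degenerate monic real cubic `v³ + bv² + cv + d` (its depressed form `x³ + A′x + B′`,
`A′ = c − b²/3`, `B′ = d − bc/3 + 2b³/27`, has `4A′³ + 27B′² = 0`) has a multiple root
`v₀ = x₀ − b/3`. [folklore] -/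
private lemma monic_cubic_multiple_root (b c d : ℝ)
    (h : 4 * (c - b ^ 2 / 3) ^ 3 + 27 * (d - b * c / 3 + 2 * b ^ 3 / 27) ^ 2 = 0) :
    ∃ v₀ : ℝ, v₀ ^ 3 + b * v₀ ^ 2 + c * v₀ + d = 0 ∧ 3 * v₀ ^ 2 + 2 * b * v₀ + c = 0 := by
  obtain ⟨x₀, hx, hx'⟩ := depressed_cubic_multiple_root _ _ h
  exact ⟨x₀ - b / 3, by linear_combination hx, by linear_combination hx'⟩

/-- **The resolvent cubic of a separable quartic at a simple root is separable.**  For a real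
quartic `q` with `a₄ ≠ 0`, no common real root of `q` and `q′`, and a root `ε`, the depressed form
`x³ + A′x + B′` of the monic resolvent cubic `D(v) = v³ + c₂v² + c₁c₃v + a₄c₃²` satisfies
`4A′³ + 27B′² ≠ 0`: a multiple root `v₀` of `D` would be nonzero (`D(0) = a₄c₃²`, `c₃ = q′(ε) ≠ 0`)
and `ε + c₃/v₀` would be a common root of `q` and `q′`, by `v⁴ q(ε + c₃/v) = c₃² D(v)` and
`v³ q′(ε + c₃/v) = c₃ (4D(v) − vD′(v))`. [cite: KontsevichZagier2001, §1.2] -/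
private lemma resolvent_depressed_nonsingular (a₄ a₃ a₂ a₁ a₀ ε : ℝ) (ha₄0 : a₄ ≠ 0)
    (hsepR : ∀ x : ℝ, a₄ * x ^ 4 + a₃ * x ^ 3 + a₂ * x ^ 2 + a₁ * x + a₀ = 0 →
      4 * a₄ * x ^ 3 + 3 * a₃ * x ^ 2 + 2 * a₂ * x + a₁ ≠ 0)
    (hq : a₄ * ε ^ 4 + a₃ * ε ^ 3 + a₂ * ε ^ 2 + a₁ * ε + a₀ = 0) :
    4 * ((4 * a₄ * ε + a₃) * (4 * a₄ * ε ^ 3 + 3 * a₃ * ε ^ 2 + 2 * a₂ * ε + a₁) -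
        (6 * a₄ * ε ^ 2 + 3 * a₃ * ε + a₂) ^ 2 / 3) ^ 3 +
      27 * (a₄ * (4 * a₄ * ε ^ 3 + 3 * a₃ * ε ^ 2 + 2 * a₂ * ε + a₁) ^ 2 -
        (4 * a₄ * ε + a₃) * (4 * a₄ * ε ^ 3 + 3 * a₃ * ε ^ 2 + 2 * a₂ * ε + a₁) *
          (6 * a₄ * ε ^ 2 + 3 * a₃ * ε + a₂) / 3 +
        2 * (6 * a₄ * ε ^ 2 + 3 * a₃ * ε + a₂) ^ 3 / 27) ^ 2 ≠ 0 := by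
  intro h
  -- `c₃ = q′(ε) ≠ 0` since `ε` is a root of the separable `q`
  have hc₃ : 4 * a₄ * ε ^ 3 + 3 * a₃ * ε ^ 2 + 2 * a₂ * ε + a₁ ≠ 0 := hsepR ε hq
  -- a multiple root `v₀` of the resolvent cubic `D`
  obtain ⟨v₀, hD, hD'⟩ := monic_cubic_multiple_root (6 * a₄ * ε ^ 2 + 3 * a₃ * ε + a₂)
    ((4 * a₄ * ε + a₃) * (4 * a₄ * ε ^ 3 + 3 * a₃ * ε ^ 2 + 2 * a₂ * ε + a₁))
    (a₄ * (4 * a₄ * ε ^ 3 + 3 * a₃ * ε ^ 2 + 2 * a₂ * ε + a₁) ^ 2) (by linear_combination h)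
  -- `v₀ ≠ 0` since `D(0) = a₄c₃² ≠ 0`
  have hv₀ : v₀ ≠ 0 := by
    rintro rfl
    have h0 : a₄ * (4 * a₄ * ε ^ 3 + 3 * a₃ * ε ^ 2 + 2 * a₂ * ε + a₁) ^ 2 = 0 := by
      linear_combination hD
    rcases mul_eq_zero.mp h0 with h0 | h0
    · exact ha₄0 h0
    · exact hc₃ (sq_eq_zero_iff.mp h0)
  -- the point `x₁ = ε + t`, `t = c₃/v₀`, i.e. `t * v₀ = c₃`
  obtain ⟨t, ht⟩ : ∃ t : ℝ, t * v₀ = 4 * a₄ * ε ^ 3 + 3 * a₃ * ε ^ 2 + 2 * a₂ * ε + a₁ :=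
    ⟨(4 * a₄ * ε ^ 3 + 3 * a₃ * ε ^ 2 + 2 * a₂ * ε + a₁) / v₀, div_mul_cancel₀ _ hv₀⟩
  -- Taylor expansion of `q` at `ε`: `q(ε + t) = t · R(t)`, `R(t) = a₄t³ + c₁t² + c₂t + c₃`
  have hTaylor : a₄ * (ε + t) ^ 4 + a₃ * (ε + t) ^ 3 + a₂ * (ε + t) ^ 2 + a₁ * (ε + t) + a₀ =
      t * (a₄ * t ^ 3 + (4 * a₄ * ε + a₃) * t ^ 2 + (6 * a₄ * ε ^ 2 + 3 * a₃ * ε + a₂) * t +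
        (4 * a₄ * ε ^ 3 + 3 * a₃ * ε ^ 2 + 2 * a₂ * ε + a₁)) := by
    linear_combination hq
  -- `R(t) · v₀³ = c₃ · D(v₀)` (using `t v₀ = c₃`)
  have hR : (a₄ * t ^ 3 + (4 * a₄ * ε + a₃) * t ^ 2 + (6 * a₄ * ε ^ 2 + 3 * a₃ * ε + a₂) * t +
        (4 * a₄ * ε ^ 3 + 3 * a₃ * ε ^ 2 + 2 * a₂ * ε + a₁)) * v₀ ^ 3 =
      (4 * a₄ * ε ^ 3 + 3 * a₃ * ε ^ 2 + 2 * a₂ * ε + a₁) *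
        (v₀ ^ 3 + (6 * a₄ * ε ^ 2 + 3 * a₃ * ε + a₂) * v₀ ^ 2 +
          (4 * a₄ * ε + a₃) * (4 * a₄ * ε ^ 3 + 3 * a₃ * ε ^ 2 + 2 * a₂ * ε + a₁) * v₀ +
          a₄ * (4 * a₄ * ε ^ 3 + 3 * a₃ * ε ^ 2 + 2 * a₂ * ε + a₁) ^ 2) := by
    linear_combination (a₄ * (t ^ 2 * v₀ ^ 2 + t * v₀ * (4 * a₄ * ε ^ 3 + 3 * a₃ * ε ^ 2 +
      2 * a₂ * ε + a₁) + (4 * a₄ * ε ^ 3 + 3 * a₃ * ε ^ 2 + 2 * a₂ * ε + a₁) ^ 2) +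
      (4 * a₄ * ε + a₃) * v₀ * (t * v₀ + (4 * a₄ * ε ^ 3 + 3 * a₃ * ε ^ 2 + 2 * a₂ * ε + a₁)) +
      (6 * a₄ * ε ^ 2 + 3 * a₃ * ε + a₂) * v₀ ^ 2) * ht
  -- hence `q(ε + t) = 0`
  have hroot : a₄ * (ε + t) ^ 4 + a₃ * (ε + t) ^ 3 + a₂ * (ε + t) ^ 2 + a₁ * (ε + t) + a₀ = 0 := by
    have hRt : (a₄ * t ^ 3 + (4 * a₄ * ε + a₃) * t ^ 2 + (6 * a₄ * ε ^ 2 + 3 * a₃ * ε + a₂) * t +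
        (4 * a₄ * ε ^ 3 + 3 * a₃ * ε ^ 2 + 2 * a₂ * ε + a₁)) * v₀ ^ 3 = 0 := by
      rw [hR, hD, mul_zero]
    rw [hTaylor, (mul_eq_zero.mp hRt).resolve_right (pow_ne_zero 3 hv₀), mul_zero]
  -- `q′(ε + t) · v₀³ = c₃ · (4 D(v₀) − v₀ D′(v₀))` (using `t v₀ = c₃`)
  have hR' : (4 * a₄ * (ε + t) ^ 3 + 3 * a₃ * (ε + t) ^ 2 + 2 * a₂ * (ε + t) + a₁) * v₀ ^ 3 =
      (4 * a₄ * ε ^ 3 + 3 * a₃ * ε ^ 2 + 2 * a₂ * ε + a₁) *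
        (4 * (v₀ ^ 3 + (6 * a₄ * ε ^ 2 + 3 * a₃ * ε + a₂) * v₀ ^ 2 +
            (4 * a₄ * ε + a₃) * (4 * a₄ * ε ^ 3 + 3 * a₃ * ε ^ 2 + 2 * a₂ * ε + a₁) * v₀ +
            a₄ * (4 * a₄ * ε ^ 3 + 3 * a₃ * ε ^ 2 + 2 * a₂ * ε + a₁) ^ 2) -
          v₀ * (3 * v₀ ^ 2 + 2 * (6 * a₄ * ε ^ 2 + 3 * a₃ * ε + a₂) * v₀ +
            (4 * a₄ * ε + a₃) * (4 * a₄ * ε ^ 3 + 3 * a₃ * ε ^ 2 + 2 * a₂ * ε + a₁))) := by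
    linear_combination (4 * a₄ * (t ^ 2 * v₀ ^ 2 + t * v₀ * (4 * a₄ * ε ^ 3 + 3 * a₃ * ε ^ 2 +
      2 * a₂ * ε + a₁) + (4 * a₄ * ε ^ 3 + 3 * a₃ * ε ^ 2 + 2 * a₂ * ε + a₁) ^ 2) +
      3 * (4 * a₄ * ε + a₃) * v₀ * (t * v₀ + (4 * a₄ * ε ^ 3 + 3 * a₃ * ε ^ 2 + 2 * a₂ * ε + a₁)) +
      2 * (6 * a₄ * ε ^ 2 + 3 * a₃ * ε + a₂) * v₀ ^ 2) * ht
  -- hence `q′(ε + t) = 0`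
  have hder : 4 * a₄ * (ε + t) ^ 3 + 3 * a₃ * (ε + t) ^ 2 + 2 * a₂ * (ε + t) + a₁ = 0 := by
    have h0 : (4 * a₄ * (ε + t) ^ 3 + 3 * a₃ * (ε + t) ^ 2 + 2 * a₂ * (ε + t) + a₁) * v₀ ^ 3 = 0 := by
      rw [hR', hD, hD']
      ring
    exact (mul_eq_zero.mp h0).resolve_right (pow_ne_zero 3 hv₀)
  -- contradiction with the separability of `q`
  exact hsepR (ε + t) hroot hder

/-- Casting the nonsingularity condition: `(−4A)³ − 27(−4B)² = −16(4A³ + 27B²)`. [folklore] -/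
private lemma neg_four_cube_sub (A B : ℝ) (h : (-4 * (A : ℂ)) ^ 3 - 27 * (-4 * (B : ℂ)) ^ 2 = 0) :
    4 * A ^ 3 + 27 * B ^ 2 = 0 := by
  have h' : ((4 * A ^ 3 + 27 * B ^ 2 : ℝ) : ℂ) = 0 := by
    push_cast
    linear_combination (-1 / 16 : ℂ) * h
  exact_mod_cast h'

/-- STUB `stub_quarticLattice` — **a lattice for the resolvent cubic** of a separable quartic at a simple root: with the
notation of `stub_quarticOvalCell` (`c₃ = q′(ε) ≠ 0`, `a₄ ≠ 0`, `q` without multiple complex roots), the monic cubic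
`D(v) = v³ + c₂v² + c₁c₃v + a₄c₃²` has three distinct roots (they are the `c₃/(e − ε)`, `e` the other roots of `q`), so its
depressed form `x³ + A′x + B′` (`A′ = c₁c₃ − c₂²/3`, `B′ = a₄c₃² − c₁c₃c₂/3 + 2c₂³/27`) has `4A′³ + 27B′² ≠ 0` and the Uniformization
Theorem (`uniformization_holds`) gives a period pair with `g₂ = −4A′`, `g₃ = −4B′`.
[cite: SilvermanAEC2009, VI.5.1] [cite: KontsevichZagier2001, §1.2] -/
theorem stub_quarticLattice (a₄ a₃ a₂ a₁ a₀ : ℝ) (ha₄ : IsAlgebraic ℚ a₄) (ha₃ : IsAlgebraic ℚ a₃)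
    (ha₂ : IsAlgebraic ℚ a₂) (ha₁ : IsAlgebraic ℚ a₁) (ha₀ : IsAlgebraic ℚ a₀) (ha₄0 : a₄ ≠ 0)
    (hsep : ∀ x : ℂ, (a₄ : ℂ) * x ^ 4 + a₃ * x ^ 3 + a₂ * x ^ 2 + a₁ * x + a₀ = 0 →
      4 * (a₄ : ℂ) * x ^ 3 + 3 * a₃ * x ^ 2 + 2 * a₂ * x + a₁ ≠ 0)
    (ε : ℝ) (hq : a₄ * ε ^ 4 + a₃ * ε ^ 3 + a₂ * ε ^ 2 + a₁ * ε + a₀ = 0) :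
    ∃ L : PeriodPair,
      L.g₂ = -4 * (((4 * a₄ * ε + a₃) * (4 * a₄ * ε ^ 3 + 3 * a₃ * ε ^ 2 + 2 * a₂ * ε + a₁) -
        (6 * a₄ * ε ^ 2 + 3 * a₃ * ε + a₂) ^ 2 / 3 : ℝ) : ℂ) ∧
      L.g₃ = -4 * ((a₄ * (4 * a₄ * ε ^ 3 + 3 * a₃ * ε ^ 2 + 2 * a₂ * ε + a₁) ^ 2 -
        (4 * a₄ * ε + a₃) * (4 * a₄ * ε ^ 3 + 3 * a₃ * ε ^ 2 + 2 * a₂ * ε + a₁) * (6 * a₄ * ε ^ 2 + 3 * a₃ * ε + a₂) / 3 +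
        2 * (6 * a₄ * ε ^ 2 + 3 * a₃ * ε + a₂) ^ 3 / 27 : ℝ) : ℂ) := by
  -- the algebraicity hypotheses belong to the registered signature but are not needed here
  have _ : IsAlgebraic ℚ a₄ ∧ IsAlgebraic ℚ a₃ ∧ IsAlgebraic ℚ a₂ ∧ IsAlgebraic ℚ a₁ ∧ IsAlgebraic ℚ a₀ :=
    ⟨ha₄, ha₃, ha₂, ha₁, ha₀⟩
  -- separability at real points is all we need
  have hsepR : ∀ x : ℝ, a₄ * x ^ 4 + a₃ * x ^ 3 + a₂ * x ^ 2 + a₁ * x + a₀ = 0 →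
      4 * a₄ * x ^ 3 + 3 * a₃ * x ^ 2 + 2 * a₂ * x + a₁ ≠ 0 := fun x hx hx' =>
    hsep x (by exact_mod_cast hx) (by exact_mod_cast hx')
  have hdisc := resolvent_depressed_nonsingular a₄ a₃ a₂ a₁ a₀ ε ha₄0 hsepR hq
  have hu : ∀ A B : ℂ, A ^ 3 - 27 * B ^ 2 ≠ 0 → ∃ L : PeriodPair, L.g₂ = A ∧ L.g₃ = B :=
    PeriodPair.uniformization_holds
  exact hu _ _ fun h => hdisc (neg_four_cube_sub _ _ h)

end Summit.KontsevichZagierPeriods.SymplecticScissors.RealOnePeriodRelations.QuarticLayer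

end
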